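import Summits.RiemannHypothesis.RiemannHypothesis.Theorems.DBNDefs
import Mathlib.Analysis.SpecialFunctions.Trigonometric.DerivHyp
import Mathlib.Analysis.Complex.Exponential
import HarnessLib

/-!
# RiemannHypothesis / DBN — the strip kernel `Q^{(η)}` and the corrector `π·sech(πw/2)` (for T13)

RH-FREE complex analysis for the boundary reduction WITH SLACK (THEORY-R4 §2 of the `pub-dbn` cell,
`Sketch4.lean` sha16 3a8b9a024097398f, target T13 `BoundaryReductionSlack`, proved in
`DBNBoundaryReductionSlack.lean`).  This file: the strip kernel (verbatim `DbnTheory4.stripKernel`),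
`cosh` on the strip in real coordinates (`cosh(a+bi) = cosh a cos b + i sinh a sin b`,
`|cosh|² = cosh² a − sin² b`), the identity `Re π·sech(πz/2) = 2π·Q^{(Im z)}(Re z)` and its vanishing
on the boundary lines `Im z = ±1`, the zero set of `cosh(πz/2)` (odd multiples of `i`), and the key
estimate that the corrector CANCELS the corner poles of the complexified descent kernel:
`‖2[(1+iw)⁻¹ + (1−iw)⁻¹] − π·sech(πw/2)‖ ≤ 2π + 2` for `w = i + t`, `0 < |t| ≤ 1/4`
(`norm_corrected_le`; via `‖sinh s − s‖ ≤ ‖s‖²`, `‖sinh s‖ ≥ ‖s‖/2`).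

`--supports stmt-RiemannHypothesis-0274`; nothing here bears on the truth of RH.
-/

noncomputable section

-- D-0017: `Summit.<S>.<S>.…` is the designed namespace of a single-problem summit.
set_option linter.dupNamespace false

open scoped Real
open Complex Set Filter Topology

namespace Summit.RiemannHypothesis.RiemannHypothesis.Theorems.DbnTheory


/-- strip kernel `Q^{(η)}(x)` (verbatim `DbnTheory4.stripKernel`). -/
def stripKernel (η x : ℝ) : ℝ :=
  (1/2) * Real.cos (π * η / 2) * Real.cosh (π * x / 2) / (Real.cosh (π * x / 2) ^ 2 - Real.sin (π * η / 2) ^ 2)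

/-! ## `cosh` on the strip: real and imaginary parts, modulus -/

/-- `cosh(a + bi) = cosh a cos b + i sinh a sin b` (real `a, b`). [folklore] -/
theorem cosh_ofReal_add_mul_I (a b : ℝ) :
    Complex.cosh (a + b * I) = ((Real.cosh a * Real.cos b : ℝ) : ℂ) + ((Real.sinh a * Real.sin b : ℝ) : ℂ) * I := by
  rw [Complex.cosh_add, Complex.cosh_mul_I, Complex.sinh_mul_I, ← ofReal_cosh, ← ofReal_sinh, ← ofReal_cos,
    ← ofReal_sin]
  push_cast
  ring

/-- `|cosh(a+bi)|² = cosh² a − sin² b`. [folklore] -/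
theorem normSq_cosh_ofReal_add_mul_I (a b : ℝ) :
    normSq (Complex.cosh (a + b * I)) = Real.cosh a ^ 2 - Real.sin b ^ 2 := by
  rw [cosh_ofReal_add_mul_I, normSq_apply]
  simp only [add_re, ofReal_re, mul_re, I_re, I_im, ofReal_im, add_im, mul_im, mul_zero, mul_one,
    sub_zero, zero_add, add_zero]
  have h1 := Real.cosh_sq a
  have h2 := Real.sin_sq_add_cos_sq b
  nlinarith [h1, h2]

/-- `Re (cosh(a+bi))⁻¹ = cosh a cos b / (cosh² a − sin² b)`. [folklore] -/
theorem re_inv_cosh_ofReal_add_mul_I (a b : ℝ) :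
    ((Complex.cosh (a + b * I))⁻¹).re = Real.cosh a * Real.cos b / (Real.cosh a ^ 2 - Real.sin b ^ 2) := by
  rw [inv_re, normSq_cosh_ofReal_add_mul_I, cosh_ofReal_add_mul_I]
  simp only [add_re, ofReal_re, mul_re, I_re, I_im, ofReal_im, mul_zero, mul_one, sub_zero, add_zero]

/-- The argument `πz/2` in the form `a + bi`. -/
theorem pi_mul_div_two_eq (z : ℂ) :
    (π : ℂ) * z / 2 = ((π * z.re / 2 : ℝ) : ℂ) + ((π * z.im / 2 : ℝ) : ℂ) * I := by
  conv_lhs => rw [← re_add_im z]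
  push_cast
  ring

/-- **Real part of the corrector**: `Re π·sech(πz/2) = 2π·Q^{(Im z)}(Re z)`. [folklore] -/
theorem re_corrector (z : ℂ) :
    ((π : ℂ) * (Complex.cosh ((π : ℂ) * z / 2))⁻¹).re = 2 * π * stripKernel z.im z.re := by
  rw [re_ofReal_mul, pi_mul_div_two_eq, re_inv_cosh_ofReal_add_mul_I]
  unfold stripKernel
  ring

/-- On the boundary lines `Im z = ±1` the corrector is purely imaginary. [folklore] -/
theorem re_corrector_of_abs_im_eq_one (z : ℂ) (hz : |z.im| = 1) :
    ((π : ℂ) * (Complex.cosh ((π : ℂ) * z / 2))⁻¹).re = 0 := by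
  rw [re_corrector]
  unfold stripKernel
  have hcos : Real.cos (π * z.im / 2) = 0 := by
    rcases abs_eq (zero_le_one) |>.mp hz with h | h
    · rw [h, mul_one, Real.cos_pi_div_two]
    · rw [h, show π * (-1 : ℝ) / 2 = -(π / 2) by ring, Real.cos_neg, Real.cos_pi_div_two]
  rw [hcos]
  ring

/-- `|cosh(πz/2)|² = cosh²(π Re z/2) − sin²(π Im z/2)`. [folklore] -/
theorem normSq_cosh_pi_half (z : ℂ) :
    normSq (Complex.cosh ((π : ℂ) * z / 2)) = Real.cosh (π * z.re / 2) ^ 2 - Real.sin (π * z.im / 2) ^ 2 := by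
  rw [pi_mul_div_two_eq, normSq_cosh_ofReal_add_mul_I]

/-- `cosh(πz/2) ≠ 0` on the closed strip `|Im z| ≤ 1` away from the corners `±i`. [folklore] -/
theorem cosh_pi_half_ne_zero {z : ℂ} (hz : |z.im| ≤ 1) (h1 : z ≠ I) (h2 : z ≠ -I) :
    Complex.cosh ((π : ℂ) * z / 2) ≠ 0 := by
  intro h0
  have hn : normSq (Complex.cosh ((π : ℂ) * z / 2)) = 0 := by rw [h0, map_zero]
  rw [normSq_cosh_pi_half] at hn
  have hcosh1 : 1 ≤ Real.cosh (π * z.re / 2) := Real.one_le_cosh _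
  have hsin1 : Real.sin (π * z.im / 2) ^ 2 ≤ 1 := by
    rw [sq_le_one_iff_abs_le_one]; exact Real.abs_sin_le_one _
  have hcosh_eq : Real.cosh (π * z.re / 2) = 1 := by nlinarith
  have hre : z.re = 0 := by
    by_contra hne
    have : 1 < Real.cosh (π * z.re / 2) := Real.one_lt_cosh.mpr (by positivity)
    linarith
  have hsin_eq : Real.sin (π * z.im / 2) ^ 2 = 1 := by nlinarith
  -- `|Im z| < 1` would make `cos(π Im z/2) > 0`, contradicting `sin² = 1`
  have him : |z.im| = 1 := by
    by_contra hne
    have hlt : |z.im| < 1 := lt_of_le_of_ne hz hne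
    have hcos : 0 < Real.cos (π * z.im / 2) := by
      apply Real.cos_pos_of_mem_Ioo
      constructor
      · have := neg_abs_le z.im; nlinarith [Real.pi_pos]
      · have := le_abs_self z.im; nlinarith [Real.pi_pos]
    have := Real.sin_sq_add_cos_sq (π * z.im / 2)
    nlinarith
  rcases abs_eq (zero_le_one) |>.mp him with h | h
  · exact h1 (Complex.ext (by simp [hre]) (by simp [h]))
  · exact h2 (Complex.ext (by simp [hre]) (by simp [h]))

/-! ## The corrector cancels the corner poles: boundedness of `G` near `±i` -/

/-- `‖sinh s − s‖ ≤ ‖s‖²` for `‖s‖ ≤ 1`. [folklore] -/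
theorem norm_sinh_sub_self_le {s : ℂ} (hs : ‖s‖ ≤ 1) : ‖Complex.sinh s - s‖ ≤ ‖s‖ ^ 2 := by
  have h1 := Complex.norm_exp_sub_one_sub_id_le hs
  have h2 := Complex.norm_exp_sub_one_sub_id_le (x := -s) (by rwa [norm_neg])
  have heq : Complex.sinh s - s = ((Complex.exp s - 1 - s) - (Complex.exp (-s) - 1 - (-s))) / 2 := by
    simp only [Complex.sinh]
    ring
  rw [heq, norm_div, Complex.norm_two]
  have := norm_sub_le (Complex.exp s - 1 - s) (Complex.exp (-s) - 1 - (-s))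
  rw [norm_neg] at h2
  linarith

/-- `‖s‖/2 ≤ ‖sinh s‖` for `‖s‖ ≤ 1/2`. [folklore] -/
theorem half_norm_le_norm_sinh {s : ℂ} (hs : ‖s‖ ≤ 1/2) : ‖s‖ / 2 ≤ ‖Complex.sinh s‖ := by
  have h := norm_sinh_sub_self_le (s := s) (by linarith)
  have h2 : ‖s‖ ^ 2 ≤ ‖s‖ / 2 := by nlinarith [norm_nonneg s]
  have h3 : ‖s‖ - ‖Complex.sinh s - s‖ ≤ ‖Complex.sinh s‖ := by
    have := norm_sub_norm_le s (Complex.sinh s - s)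
    rw [show s - (Complex.sinh s - s) = -(Complex.sinh s - 2 * s) by ring] at this
    have := abs_norm_sub_norm_le s (s - Complex.sinh s)
    -- direct: ‖s‖ ≤ ‖sinh s‖ + ‖s - sinh s‖
    have h4 := norm_le_norm_add_norm_sub' s (Complex.sinh s)
    have h5 : ‖s - Complex.sinh s‖ = ‖Complex.sinh s - s‖ := norm_sub_rev _ _
    linarith
  linarith

/-- `cosh(π(i+t)/2) = i·sinh(πt/2)`. [folklore] -/
theorem cosh_pi_half_I_add (t : ℂ) :
    Complex.cosh ((π : ℂ) * (I + t) / 2) = Complex.sinh ((π : ℂ) * t / 2) * I := by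
  have h : (π : ℂ) * (I + t) / 2 = (π : ℂ) * t / 2 + (π / 2 : ℂ) * I := by ring
  rw [h, Complex.cosh_add, Complex.cosh_mul_I, Complex.sinh_mul_I, Complex.cos_pi_div_two,
    Complex.sin_pi_div_two]
  ring

/-- **The poles cancel**: `‖G(i + t)‖ ≤ 2π + 2` for `0 < ‖t‖ ≤ 1/4`, where
`G(w) = 2[(1+iw)⁻¹ + (1−iw)⁻¹] − π·(cosh(πw/2))⁻¹`. [folklore] -/
theorem norm_corrected_le (t : ℂ) (ht0 : t ≠ 0) (ht : ‖t‖ ≤ 1/4) :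
    ‖2 * (((1:ℂ) + I * (I + t))⁻¹ + ((1:ℂ) - I * (I + t))⁻¹)
      - (π : ℂ) * (Complex.cosh ((π : ℂ) * (I + t) / 2))⁻¹‖ ≤ 2 * π + 2 := by
  set s : ℂ := (π : ℂ) * t / 2 with hs
  have hπ : ‖(π : ℂ)‖ = π := by rw [norm_real, Real.norm_of_nonneg Real.pi_pos.le]
  have hns : ‖s‖ = π * ‖t‖ / 2 := by rw [hs, norm_div, norm_mul, hπ, Complex.norm_two]
  have hs_half : ‖s‖ ≤ 1/2 := by rw [hns]; nlinarith [Real.pi_le_four, norm_nonneg t, Real.pi_pos]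
  have hs1 : ‖s‖ ≤ 1 := by linarith
  have hsinh0 : Complex.sinh s ≠ 0 := by
    intro h0
    have h := half_norm_le_norm_sinh hs_half
    rw [h0, norm_zero] at h
    have : ‖t‖ = 0 := by nlinarith [norm_nonneg t, Real.pi_pos, hns]
    exact ht0 (norm_eq_zero.mp this)
  have h1 : (1:ℂ) + I * (I + t) = I * t := by rw [mul_add, I_mul_I]; ring
  have h2 : (1:ℂ) - I * (I + t) = 2 - I * t := by rw [mul_add, I_mul_I]; ring
  rw [h1, h2, cosh_pi_half_I_add, ← hs]
  -- split: `G = I⁻¹ (2/t − π/ sinh s) + 2/(2 − I t)`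
  have hsplit : 2 * ((I * t)⁻¹ + ((2:ℂ) - I * t)⁻¹) - (π : ℂ) * (Complex.sinh s * I)⁻¹
      = I⁻¹ * ((2 * Complex.sinh s - (π : ℂ) * t) * (t * Complex.sinh s)⁻¹) + 2 * ((2:ℂ) - I * t)⁻¹ := by
    field_simp
    ring
  rw [hsplit]
  have hA : ‖(2 * Complex.sinh s - (π : ℂ) * t) * (t * Complex.sinh s)⁻¹‖ ≤ 2 * π := by
    have hnum : ‖2 * Complex.sinh s - (π : ℂ) * t‖ ≤ 2 * ‖s‖ ^ 2 := by
      have : 2 * Complex.sinh s - (π : ℂ) * t = 2 * (Complex.sinh s - s) := by rw [hs]; ring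
      rw [this, norm_mul, Complex.norm_two]
      nlinarith [norm_sinh_sub_self_le hs1, norm_nonneg (Complex.sinh s - s)]
    have hden : ‖t‖ * (‖s‖ / 2) ≤ ‖t * Complex.sinh s‖ := by
      rw [norm_mul]
      exact mul_le_mul_of_nonneg_left (half_norm_le_norm_sinh hs_half) (norm_nonneg t)
    have ht_pos : 0 < ‖t‖ := norm_pos_iff.mpr ht0
    have hs_pos : 0 < ‖s‖ := by rw [hns]; positivity
    have hden_pos : 0 < ‖t * Complex.sinh s‖ := lt_of_lt_of_le (by positivity) hden
    rw [norm_mul, norm_inv]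
    rw [← div_eq_mul_inv, div_le_iff₀ hden_pos]
    calc ‖2 * Complex.sinh s - (π : ℂ) * t‖ ≤ 2 * ‖s‖ ^ 2 := hnum
      _ = 2 * π * (‖t‖ * (‖s‖ / 2)) := by rw [hns]; ring
      _ ≤ 2 * π * ‖t * Complex.sinh s‖ := by
          exact mul_le_mul_of_nonneg_left hden (by positivity)
  have hB : ‖((2:ℂ) - I * t)⁻¹‖ ≤ 1 := by
    have hlow : 1 ≤ ‖(2:ℂ) - I * t‖ := by
      have := norm_sub_norm_le (2:ℂ) (I * t)
      rw [Complex.norm_two, norm_mul, norm_I, one_mul] at this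
      linarith
    rw [norm_inv]
    exact inv_le_one_of_one_le₀ hlow
  calc ‖I⁻¹ * ((2 * Complex.sinh s - (π : ℂ) * t) * (t * Complex.sinh s)⁻¹) + 2 * ((2:ℂ) - I * t)⁻¹‖
      ≤ ‖I⁻¹ * ((2 * Complex.sinh s - (π : ℂ) * t) * (t * Complex.sinh s)⁻¹)‖ + ‖2 * ((2:ℂ) - I * t)⁻¹‖ :=
        norm_add_le _ _
    _ ≤ 2 * π + 2 := by
        have hA' : ‖I⁻¹ * ((2 * Complex.sinh s - (π : ℂ) * t) * (t * Complex.sinh s)⁻¹)‖ ≤ 2 * π := by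
          rw [norm_mul, norm_inv, norm_I, inv_one, one_mul]; exact hA
        have hB' : ‖2 * ((2:ℂ) - I * t)⁻¹‖ ≤ 2 := by
          rw [norm_mul, Complex.norm_two]; linarith
        linarith

end Summit.RiemannHypothesis.RiemannHypothesis.Theorems.DbnTheory

end
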